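import Literature.Analysis.FunctionSpaces.PeriodicPrimitiveMeanZero
import HarnessLib

/-!
# The mean-zero primitive along a periodic orbit: shift covariance and smooth dependence

Analysis/FunctionSpaces support file, continuing `PeriodicPrimitive.lean` and
`PeriodicPrimitiveMeanZero.lean` (averaging along the orbits of a circle action; McDuff–Salamon
2017, §5.5; McLean 2012, proof of Lemma 5.17).  For a continuous `T`-periodic `γ : ℝ → ℝ`
(in the application `γ(σ) = g(R_σ x)`, a function read along the orbit of a `T`-periodic flow)
write

* `avg γ = T⁻¹ ∫₀ᵀ γ`,
* `P γ (t) = ∫₀ᵗ γ - t · avg γ` (the periodic primitive with `P γ (0) = 0`),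
* `F γ (t) = P γ (t) - T⁻¹ ∫₀ᵀ P γ` (the **mean-zero** periodic primitive).

All three are written out explicitly in the statements (no definitions are introduced).  Results:

* `hasDerivAt_meanZeroPrimitive`, `meanZeroPrimitive_add_period`,
  `integral_meanZeroPrimitive_eq_zero` — `F' = γ - avg γ`, `F` is `T`-periodic with zero mean;
* `intervalIntegral_comp_add_period`, `average_comp_add` — the average is shift invariant;
* `meanZeroPrimitive_comp_add` — **shift covariance** `F (γ(· + s)) (t) = F γ (t + s)` (both
  sides are mean-zero primitives of `γ(· + s) - avg`; uniqueness
  `eq_of_deriv_eq_of_integral_eq`);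
* `hasDerivAt_meanZeroValue_comp_add` — hence the value at `0`, `s ↦ F (γ(· + s)) (0)`, i.e. the
  function `x ↦ F(γ_x)(0)` read along the orbit, has derivative `γ s - avg γ`: **the orbitwise
  mean-zero primitive `h` solves `X·h = g - ⟨g⟩`** (McDuff–Salamon 2017, §5.5);
* `contDiff_average_param`, `contDiff_meanZeroValue_param` — for a jointly `C^∞` family
  `Γ : ℝ × Q → ℝ` the average and the mean-zero value depend smoothly on the parameter.

Everything is proved; no definitions, no named facts (D-0026).

## References

* D. McDuff, D. Salamon, *Introduction to Symplectic Topology*, 3rd ed. (2017), §5.5.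
  [McDuffSalamon2017]
* M. McLean, *The growth rate of symplectic homology and affine varieties*, Geom. Funct. Anal. 22
  (2012), proof of Lemma 5.17. [Mclean2012]
-/

noncomputable section

open MeasureTheory Set Filter Topology intervalIntegral
open scoped ContDiff

namespace Literature.Analysis.FunctionSpaces

/-! ### One periodic function: the mean-zero primitive -/

section OneOrbit

variable {γ : ℝ → ℝ} {T : ℝ}

/-- `F' = γ - avg γ` for the (mean-zero) periodic primitive of a continuous `γ`. [folklore] -/
theorem hasDerivAt_meanZeroPrimitive (hγ : Continuous γ) (c : ℝ) (t : ℝ) :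
    HasDerivAt (fun t : ℝ ↦
        (∫ σ in (0 : ℝ)..t, γ σ) - t * (T⁻¹ * ∫ σ in (0 : ℝ)..T, γ σ) - c)
      (γ t - T⁻¹ * ∫ σ in (0 : ℝ)..T, γ σ) t := by
  have h1 : HasDerivAt (fun t : ℝ ↦ ∫ σ in (0 : ℝ)..t, γ σ) (γ t) t :=
    integral_hasDerivAt_right (hγ.intervalIntegrable _ _)
      hγ.aestronglyMeasurable.stronglyMeasurableAtFilter hγ.continuousAt
  have h2 : HasDerivAt (fun t : ℝ ↦ t * (T⁻¹ * ∫ σ in (0 : ℝ)..T, γ σ))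
      (T⁻¹ * ∫ σ in (0 : ℝ)..T, γ σ) t := by
    simpa using (hasDerivAt_id t).mul_const (T⁻¹ * ∫ σ in (0 : ℝ)..T, γ σ)
  exact (h1.sub h2).sub_const c

/-- Shift invariance of the integral over a period: `∫₀ᵀ γ(σ + s) dσ = ∫₀ᵀ γ`. [folklore] -/
theorem intervalIntegral_comp_add_period (hper : Function.Periodic γ T) (s : ℝ) :
    ∫ σ in (0 : ℝ)..T, γ (σ + s) = ∫ σ in (0 : ℝ)..T, γ σ := by
  rw [intervalIntegral.integral_comp_add_right (fun σ ↦ γ σ) s, zero_add]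
  have h := hper.intervalIntegral_add_eq s 0
  rw [zero_add] at h
  rw [show T + s = s + T by ring] at *
  exact h

/-- The periodic primitive gains nothing over a period: `P γ (t + T) = P γ (t)`. [folklore] -/
theorem meanZeroPrimitive_add_period (hγ : Continuous γ) (hT : T ≠ 0)
    (hper : Function.Periodic γ T) (c : ℝ) (t : ℝ) :
    (∫ σ in (0 : ℝ)..t + T, γ σ) - (t + T) * (T⁻¹ * ∫ σ in (0 : ℝ)..T, γ σ) - c =
      (∫ σ in (0 : ℝ)..t, γ σ) - t * (T⁻¹ * ∫ σ in (0 : ℝ)..T, γ σ) - c := by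
  have hi : IntervalIntegrable γ volume 0 t := hγ.intervalIntegrable _ _
  have hi' : IntervalIntegrable γ volume t (t + T) := hγ.intervalIntegrable _ _
  have hsplit : ∫ σ in (0 : ℝ)..t + T, γ σ = (∫ σ in (0 : ℝ)..t, γ σ) + ∫ σ in t..t + T, γ σ :=
    (integral_add_adjacent_intervals hi hi').symm
  have hshift : ∫ σ in t..t + T, γ σ = ∫ σ in (0 : ℝ)..T, γ σ := by
    have h := hper.intervalIntegral_add_eq t 0
    rwa [zero_add] at h
  rw [hsplit, hshift]
  field_simp
  ring

/-- **The mean-zero primitive has zero mean**: with `c = T⁻¹ ∫₀ᵀ P γ`,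
`∫₀ᵀ (P γ - c) = 0` (`T ≠ 0`). [folklore] -/
theorem integral_meanZeroPrimitive_eq_zero (hγ : Continuous γ) (hT : T ≠ 0) :
    ∫ τ in (0 : ℝ)..T, ((∫ σ in (0 : ℝ)..τ, γ σ) - τ * (T⁻¹ * ∫ σ in (0 : ℝ)..T, γ σ) -
      T⁻¹ * ∫ τ' in (0 : ℝ)..T,
        ((∫ σ in (0 : ℝ)..τ', γ σ) - τ' * (T⁻¹ * ∫ σ in (0 : ℝ)..T, γ σ))) = 0 := by
  have hPc : Continuous fun τ : ℝ ↦
      (∫ σ in (0 : ℝ)..τ, γ σ) - τ * (T⁻¹ * ∫ σ in (0 : ℝ)..T, γ σ) :=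
    (continuous_primitive (fun _ _ ↦ hγ.intervalIntegrable _ _) 0).sub
      (continuous_id.mul continuous_const)
  rw [intervalIntegral.integral_sub (hPc.intervalIntegrable _ _) intervalIntegrable_const,
    intervalIntegral.integral_const, sub_zero, smul_eq_mul, ← mul_assoc, mul_inv_cancel₀ hT,
    one_mul, sub_self]

/-- **Shift covariance of the mean-zero primitive**: `F (γ(· + s)) (t) = F γ (t + s)` for a
continuous `T`-periodic `γ` (`T ≠ 0`): both sides are primitives of `γ(· + s) - avg γ` with zero
mean over a period, hence equal (`eq_of_deriv_eq_of_integral_eq`).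
[cite: McDuffSalamon2017, §5.5 (averaging over a circle action)] -/
theorem meanZeroPrimitive_comp_add (hγ : Continuous γ) (hT : T ≠ 0)
    (hper : Function.Periodic γ T) (s t : ℝ) :
    (∫ σ in (0 : ℝ)..t, γ (σ + s)) - t * (T⁻¹ * ∫ σ in (0 : ℝ)..T, γ (σ + s)) -
        T⁻¹ * ∫ τ in (0 : ℝ)..T,
          ((∫ σ in (0 : ℝ)..τ, γ (σ + s)) - τ * (T⁻¹ * ∫ σ in (0 : ℝ)..T, γ (σ + s))) =
      (∫ σ in (0 : ℝ)..t + s, γ σ) - (t + s) * (T⁻¹ * ∫ σ in (0 : ℝ)..T, γ σ) -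
        T⁻¹ * ∫ τ in (0 : ℝ)..T,
          ((∫ σ in (0 : ℝ)..τ, γ σ) - τ * (T⁻¹ * ∫ σ in (0 : ℝ)..T, γ σ)) := by
  -- the two candidate functions of `t`
  set γs : ℝ → ℝ := fun σ ↦ γ (σ + s) with hγs
  have hγsc : Continuous γs := hγ.comp (continuous_id.add continuous_const)
  have hγsper : Function.Periodic γs T := fun σ ↦ by
    simp only [hγs]
    rw [show σ + T + s = σ + s + T by ring]
    exact hper (σ + s)
  set c₁ : ℝ := T⁻¹ * ∫ τ in (0 : ℝ)..T,
    ((∫ σ in (0 : ℝ)..τ, γs σ) - τ * (T⁻¹ * ∫ σ in (0 : ℝ)..T, γs σ)) with hc₁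
  set c₂ : ℝ := T⁻¹ * ∫ τ in (0 : ℝ)..T,
    ((∫ σ in (0 : ℝ)..τ, γ σ) - τ * (T⁻¹ * ∫ σ in (0 : ℝ)..T, γ σ)) with hc₂
  set F₁ : ℝ → ℝ := fun t ↦
    (∫ σ in (0 : ℝ)..t, γs σ) - t * (T⁻¹ * ∫ σ in (0 : ℝ)..T, γs σ) - c₁ with hF₁
  set F₂ : ℝ → ℝ := fun t ↦
    (∫ σ in (0 : ℝ)..t + s, γ σ) - (t + s) * (T⁻¹ * ∫ σ in (0 : ℝ)..T, γ σ) - c₂ with hF₂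
  -- same derivative
  have havg : T⁻¹ * ∫ σ in (0 : ℝ)..T, γs σ = T⁻¹ * ∫ σ in (0 : ℝ)..T, γ σ := by
    simp only [hγs]
    rw [intervalIntegral_comp_add_period hper s]
  have hd₁ : ∀ t, HasDerivAt F₁ (γs t - T⁻¹ * ∫ σ in (0 : ℝ)..T, γs σ) t :=
    fun t ↦ hasDerivAt_meanZeroPrimitive hγsc c₁ t
  have hd₂ : ∀ t, HasDerivAt F₂ (γ (t + s) - T⁻¹ * ∫ σ in (0 : ℝ)..T, γ σ) t := fun t ↦ by
    have h := hasDerivAt_meanZeroPrimitive (T := T) hγ c₂ (t + s)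
    have h2 : HasDerivAt (fun t : ℝ ↦ t + s) 1 t := (hasDerivAt_id t).add_const s
    have h3 := h.comp t h2
    simp only [mul_one] at h3
    exact h3
  have hD₁ : Differentiable ℝ F₁ := fun t ↦ (hd₁ t).differentiableAt
  have hD₂ : Differentiable ℝ F₂ := fun t ↦ (hd₂ t).differentiableAt
  have hderiv : ∀ t, deriv F₁ t = deriv F₂ t := fun t ↦ by
    rw [(hd₁ t).deriv, (hd₂ t).deriv, havg]
  -- same (zero) integral over a period
  have hI₁ : ∫ τ in (0 : ℝ)..T, F₁ τ = 0 := integral_meanZeroPrimitive_eq_zero hγsc hT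
  have hF₂per : Function.Periodic F₂ T := fun t ↦ by
    simp only [hF₂]
    rw [show t + T + s = (t + s) + T by ring]
    exact meanZeroPrimitive_add_period hγ hT hper c₂ (t + s)
  have hI₂ : ∫ τ in (0 : ℝ)..T, F₂ τ = 0 := by
    have h0 : ∫ τ in (0 : ℝ)..T, F₂ (τ + -s) = ∫ τ in (0 : ℝ)..T, F₂ τ :=
      intervalIntegral_comp_add_period hF₂per (-s)
    rw [← h0]
    have hfun : (fun τ ↦ F₂ (τ + -s)) = fun τ ↦
        (∫ σ in (0 : ℝ)..τ, γ σ) - τ * (T⁻¹ * ∫ σ in (0 : ℝ)..T, γ σ) - c₂ := by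
      funext τ
      simp only [hF₂]
      rw [show τ + -s + s = τ by ring]
    rw [hfun]
    exact integral_meanZeroPrimitive_eq_zero hγ hT
  have heq : F₁ = F₂ := eq_of_deriv_eq_of_integral_eq hD₁ hD₂ hderiv hT (hI₁.trans hI₂.symm)
  have := congrFun heq t
  simpa only [hF₁, hF₂] using this

/-- **The mean-zero value along the orbit solves the averaged equation**: for a continuous
`T`-periodic `γ` (`T ≠ 0`) the function `s ↦ F (γ(· + s)) (0) = -T⁻¹ ∫₀ᵀ P (γ(· + s))` — the
value at the orbit point `R_s x` of the orbitwise mean-zero primitive — has derivative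
`γ s - avg γ` (McDuff–Salamon 2017, §5.5: `X·h = g - ⟨g⟩`).
[cite: McDuffSalamon2017, §5.5 (averaging over a circle action)] -/
theorem hasDerivAt_meanZeroValue_comp_add (hγ : Continuous γ) (hT : T ≠ 0)
    (hper : Function.Periodic γ T) (s : ℝ) :
    HasDerivAt (fun s : ℝ ↦ -(T⁻¹ * ∫ τ in (0 : ℝ)..T,
        ((∫ σ in (0 : ℝ)..τ, γ (σ + s)) - τ * (T⁻¹ * ∫ σ in (0 : ℝ)..T, γ (σ + s)))))
      (γ s - T⁻¹ * ∫ σ in (0 : ℝ)..T, γ σ) s := by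
  have hfun : (fun s : ℝ ↦ -(T⁻¹ * ∫ τ in (0 : ℝ)..T,
      ((∫ σ in (0 : ℝ)..τ, γ (σ + s)) - τ * (T⁻¹ * ∫ σ in (0 : ℝ)..T, γ (σ + s))))) =
      fun s : ℝ ↦ (∫ σ in (0 : ℝ)..s, γ σ) - s * (T⁻¹ * ∫ σ in (0 : ℝ)..T, γ σ) -
        T⁻¹ * ∫ τ in (0 : ℝ)..T,
          ((∫ σ in (0 : ℝ)..τ, γ σ) - τ * (T⁻¹ * ∫ σ in (0 : ℝ)..T, γ σ)) := by
    funext s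
    have h := meanZeroPrimitive_comp_add hγ hT hper s 0
    simp only [intervalIntegral.integral_same, zero_mul, sub_zero, zero_sub, zero_add] at h
    exact h
  rw [hfun]
  exact hasDerivAt_meanZeroPrimitive hγ _ s

end OneOrbit

/-! ### Smooth dependence on parameters -/

section Param

variable {Q : Type*} [NormedAddCommGroup Q] [NormedSpace ℝ Q] [FiniteDimensional ℝ Q]

/-- The orbit average `q ↦ T⁻¹ ∫₀ᵀ Γ (σ, q) dσ` of a jointly `C^∞` family is `C^∞`. [folklore] -/
theorem contDiff_average_param {Γ : ℝ × Q → ℝ} (hΓ : ContDiff ℝ ∞ Γ) (T : ℝ) :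
    ContDiff ℝ ∞ fun q : Q ↦ T⁻¹ * ∫ σ in (0 : ℝ)..T, Γ (σ, q) :=
  contDiff_const.mul (contDiff_parametric_average hΓ T)

/-- **The mean-zero value depends smoothly on parameters**: for a jointly `C^∞` family
`Γ : ℝ × Q → ℝ`, the function `q ↦ -T⁻¹ ∫₀ᵀ (∫₀^τ Γ(σ, q) dσ - τ · T⁻¹ ∫₀ᵀ Γ(σ, q) dσ) dτ`
is `C^∞` (parametric integrals of smooth integrands). [folklore] -/
theorem contDiff_meanZeroValue_param {Γ : ℝ × Q → ℝ} (hΓ : ContDiff ℝ ∞ Γ) (T : ℝ) :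
    ContDiff ℝ ∞ fun q : Q ↦ -(T⁻¹ * ∫ τ in (0 : ℝ)..T,
      ((∫ σ in (0 : ℝ)..τ, Γ (σ, q)) - τ * (T⁻¹ * ∫ σ in (0 : ℝ)..T, Γ (σ, q)))) := by
  have hK : ContDiff ℝ ∞ fun x : Q × ℝ ↦
      (∫ σ in (0 : ℝ)..x.2, Γ (σ, x.1)) - x.2 * (T⁻¹ * ∫ σ in (0 : ℝ)..T, Γ (σ, x.1)) :=
    contDiff_periodicPrimitive hΓ T
  exact (contDiff_const.mul (contDiff_tAverage hK T)).neg

end Param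

end Literature.Analysis.FunctionSpaces
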